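import Literature.MathematicalPhysics.QuantumFieldTheory.Balaban1983to89.B10Eq44OnDomain

/-!
# `Balaban1983to89.B10Eq44LoopLocal` — T. Bałaban, *Ultraviolet stability of three-dimensional lattice pure gauge field
# theories*, Commun. Math. Phys. **102** (1985) 255–275 [Balaban1985UV3]: the loop-variable factor of (44) p. 267,
# `|B_k(c)| ≤ (L^jη)^{−1}|c₋ − y| · 8L²B₃g_{k−1}p(g_{k−1})(L^jη)²`, WITH THE PRINTED LOCALITY — the regularity of `U_k`
# assumed only on the fine lattice under a box of the `L^jη`-lattice containing `y`, `c₋`, `c₊` (theorems only)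

statement-level skeleton of published theorems with citation tags; proofs where landed; nothing here is a claim
about the Yang–Mills mass gap

PDF held: `paper:balaban1985-cmp102-uv-stability-3d` (journal page = PDF page + 254); p. 267 (PDF 13), p. 263 (PDF 9).
"[4]" = [Balaban1985Averaging] (cell paper B7).

WHAT IS REPRODUCED (cell `pub-ymgap`, seat `pub-ymgap-dag-n08-d` gen 2; companion of `B10Eq44AvgRegularity` (§3
`loop44_le`, GLOBAL regularity) and `B10Eq44OnDomain` (the sentence before (44) with its printed domain clauses)).
THE PRINTED TEXT (p. 267 L1–5): *"The configuration `U_k` satisfies the following regularity condition on `Ω_k`: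
`|U_k(∂p) − 1| < 2L²B₃g_{k−1}p(g_{k−1})η²`. This implies the condition `|Ū_k^j(∂p′) − 1| < 4L²B₃g_{k−1}p(g_{k−1})(L^jη)²`
for `p′ ⊂ Ω_k^{(j)}`, and from (43) we get `|𝒫_j(Y_j, U_k)| ≤ O(1) Π … × (L^jη)^{−1}|c_{i,−} − y| 8L²B₃g_{k−1}p(g_{k−1})
(L^jη)²`. (44)"*, with (43) p. 266: *"`B_k(c) = (1/i) log Ū_k^j(Γ_{y,c₋} ∪ c ∪ Γ_{c₊,y})`, `c ∈ Ω_k^{(j)}`"* and the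
locality of the averages, [4] p. 24: *"`Ū^k_c`, `c ⊂ Ω^{(k)}`, depends only on the bond variables `U_b` for `b ⊂ B^k(c₋)
∪ B^k(c₊)`"*.  The tree's `B10Eq44AvgRegularity.loop44_le` proves the loop-variable factor of (44) for the concrete
`j`-fold average `Ū_k^j = B7Prop2Explicit.avgIter L U j` on `ℤ^d` from the regularity of `U_k` on ALL of `ηℤ^d`
(`pdev U < 2L²B₃εη²`).  THIS FILE supplies the printed locality "on `Ω_k`": the contour `Γ_{y,c₋} ∪ c ∪ Γ_{c₊,y}` of (27)
read from `y` stays in any box `[lo, hi]` of the `L^jη`-lattice containing `y`, `c₋ = x`, `c₊ = x + e_μ`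
(`B10Eq27AxialLog.B27_congr`), the averages on the bonds of that box depend only on `U_k` on the fine box
`[L^j lo, L^j hi + (L^j − 1)𝟙]` under it (`B7Prop1Local.avgIter_congr`), and the clamped extension
`B7Prop1Local.clampCfg` of `U_k` from that fine box is `G`-valued and regular on all of `ηℤ^d`
(`B7Prop1Local.pdev_clampCfg_le`) — so `loop44_le` applies to it and gives the bound for the ORIGINAL loop variable:
`loop44_le_local` (regularity as `pdevOn` of the fine box), `loop44_le_local_of_forall` (regularity plaquette by
plaquette, strictness by finiteness `B8Ineq132.pdevOn_lt_of_forall`), `loop44_le_local_unitaryGroup` (`G = U(N) ⊂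
M_N(ℂ)`, operator norm (19) of [4]).  The mechanism is that of `B7Prop1Local.prop2_local` (Prop. 2 of [4] with the
printed locality).
MODEL NOTES.  (M1)–(M5) of `B10Eq44AvgRegularity` (lattices `ηℤ^d ≅ ℤ^d`, `Ω_k^{(j)} ≅ ℤ^d` via `z ↦ L^jz`; `U_k` ANY
configuration with the printed regularity, here only on the fine box; explicit smallness `C₀·2L²B₃ε ≤ ⅓`, `4L²B₃ε ≤
c₂′(d, L)`, and the bond restriction `|c₋ − y|₁·4L²B₃ε(L^jη)² ≤ ½`; `AvgClosed` gauge groups, e.g. `U(N)`; any `d`,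
`L ≥ 2`; `|c₋ − y|` = the `ℓ¹` lattice length `B7Prop1Explicit.l1`).  (M8) "on `Ω_k`" for a loop variable is read as:
regularity on the unit plaquettes of the fine box under a scale-`j` coordinate box containing the three points `y`,
`c₋`, `c₊` of the contour — the box is the caller's (the minimal one is `[y ⊓ c₋, y ⊔ c₊]`).  No `sorry`, no
definitions, no new named facts; axioms `propext`, `Classical.choice`, `Quot.sound`.
-/

noncomputable section

open scoped BigOperators
open NormedSpace Finset

namespace Literature.MathematicalPhysics.QuantumFieldTheory.Balaban1983to89.B10Eq44LoopLocal

open B7Prop1Explicit B7Prop2Explicit B7Prop1Local B10Eq44AvgRegularity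
open B10Eq27AxialLog (B27 B27_congr)
open B8Ineq132 (pdevOn_lt_of_forall)

export B7Prop1Explicit (Site) -- the `ℤ^d` sites (the torus `Site` of `Setup.lean` would shadow them)

variable {d : ℕ}

/-! ## §1 The fine box under a scale-`j` box and the locality of the averages on it -/

/-- `L^j lo ≤ L^j hi + (L^j − 1)𝟙` coordinatewise when `lo ≤ hi` and `L ≥ 1`. [folklore] -/
private theorem loK_le_fineHi {L : ℕ} (hL : 1 ≤ L) (j : ℕ) {lo hi : Site d} (hlohi : ∀ i, lo i ≤ hi i) (i : Fin d) :
    loK L j lo i ≤ (L : ℤ) ^ j * hi i + ((L : ℤ) ^ j - 1) := by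
  have hP : (1 : ℤ) ≤ (L : ℤ) ^ j := one_le_pow₀ (by exact_mod_cast hL)
  simp only [loK]
  nlinarith [hlohi i]

/-- **Locality of `Ū^j` on a box** ([4] p. 24, the sentence after (43)): two configurations agreeing on the bonds of
the fine box `[L^j lo, L^j hi + (L^j − 1)𝟙]` have the same `j`-fold averages on every bond of the scale-`j` box
`[lo, hi]` (`B7Prop1Local.avgIter_congr` bond by bond: `B^j(c₋) ∪ B^j(c₊)` lies under the box).
[cite: Balaban1985Averaging, p.24 (sentence after (43))] -/
theorem agreeOn_avgIter_of_agreeOn_fine {𝔸 : Type*} [NormedRing 𝔸] [NormOneClass 𝔸]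
    [NormedAlgebra ℂ 𝔸] [CompleteSpace 𝔸] (L : ℕ) (hL : 1 ≤ L) (j : ℕ) {lo hi : Site d}
    {V V' : Site d → Fin d → 𝔸ˣ}
    (h : AgreeOn (loK L j lo) (fun i => (L : ℤ) ^ j * hi i + ((L : ℤ) ^ j - 1)) V V') :
    AgreeOn lo hi (avgIter L V j) (avgIter L V' j) := by
  intro q κ hq hqe
  have hP : (0 : ℤ) ≤ (L : ℤ) ^ j := by positivity
  refine avgIter_congr L hL j q κ (h.mono (fun i => ?_) (fun i => ?_))
  · simp only [loK]
    exact mul_le_mul_of_nonneg_left (hq i).1 hP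
  · have h2 := (hqe i).2
    rw [add_e_apply] at h2
    have h2' := mul_le_mul_of_nonneg_left h2 hP
    simp only [bondHiK]
    split_ifs at h2' ⊢ <;> nlinarith

/-! ## §2 The factor of (44) under the printed locality -/

section Loop

variable {𝔸 : Type*} [NormedRing 𝔸] [NormOneClass 𝔸] [NormedAlgebra ℂ 𝔸] [CompleteSpace 𝔸]

/-- **The factor of (44), regularity ON THE FINE BOX ONLY** (`ε` = `g_{k−1}p(g_{k−1})`): for a `G`-valued `U_k`
(`G` any `AvgClosed` gauge group, e.g. `U(N)`), `L ≥ 2`, [4] Prop. 2's smallness for `α₀ = 2L²B₃ε`, `j ≤ k`, a box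
`[lo, hi]` of the `L^jη`-lattice containing `y`, `c₋ = x`, `c₊ = x + e_μ`, and `sup |U_k(∂p) − 1| < 2L²B₃εη²` over the
unit plaquettes `p` of the fine box `[L^j lo, L^j hi + (L^j − 1)𝟙]` under it, the loop variable `B_k(c) = (1/i) log
Ū_k^j(Γ_{y,c₋} ∪ c ∪ Γ_{c₊,y})` (`B10Eq27AxialLog.B27` of the concrete `Ū_k^j`) satisfies `|B_k(c)| ≤ |c₋ − y|₁ ·
8L²B₃ε(L^jη)²` whenever `|c₋ − y|₁·4L²B₃ε(L^jη)² ≤ ½`.  Proof: `B10Eq44AvgRegularity.loop44_le` for the clamped extension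
`B7Prop1Local.clampCfg` of `U_k` from the fine box (globally regular by `pdev_clampCfg_le`, `G`-valued by `clampCfg_mem`),
whose `Ū^j` agrees with that of `U_k` on the bonds of `[lo, hi]` (`agreeOn_avgIter_of_agreeOn_fine`), so that the two
loop variables coincide (`B10Eq27AxialLog.B27_congr`). [cite: Balaban1985UV3, (44) p.267] -/
theorem loop44_le_local (L : ℕ) (hL : 2 ≤ L) {G : Subgroup 𝔸ˣ} (hG : AvgClosed d L G) (k : ℕ)
    (U : Site d → Fin d → 𝔸ˣ) (hU : ∀ x κ, U x κ ∈ G) {B₃ ε : ℝ} (hpos : 0 < (L : ℝ) ^ 2 * B₃ * ε)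
    (hα3 : C0 d * (2 * (L : ℝ) ^ 2 * B₃ * ε) ≤ 1 / 3) (hα2 : 2 * (2 * (L : ℝ) ^ 2 * B₃ * ε) ≤ c2' d L)
    {j : ℕ} (hj : j ≤ k) {lo hi : Site d} (y x : Site d) (μ : Fin d) (hy : InBox lo hi y) (hx : InBox lo hi x)
    (hxe : InBox lo hi (x + e μ))
    (hreg : pdevOn (loK L j lo) (fun i => (L : ℤ) ^ j * hi i + ((L : ℤ) ^ j - 1)) U
      < 2 * (L : ℝ) ^ 2 * B₃ * ε * (((L : ℝ) ^ k)⁻¹) ^ 2)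
    (hsmall : (l1 (x - y) : ℝ) * (4 * (L : ℝ) ^ 2 * B₃ * ε * ((L : ℝ) ^ j * ((L : ℝ) ^ k)⁻¹) ^ 2) ≤ 1 / 2) :
    ‖B27 (avgIter L U j) y x μ‖
      ≤ (l1 (x - y) : ℝ) * (8 * (L : ℝ) ^ 2 * B₃ * ε * ((L : ℝ) ^ j * ((L : ℝ) ^ k)⁻¹) ^ 2) := by
  have hL1 : 1 ≤ L := le_trans (by norm_num) hL
  have hlohi : ∀ i, loK L j lo i ≤ (L : ℤ) ^ j * hi i + ((L : ℤ) ^ j - 1) :=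
    loK_le_fineHi hL1 j (fun i => (hy i).1.trans (hy i).2)
  set U' := clampCfg (loK L j lo) (fun i => (L : ℤ) ^ j * hi i + ((L : ℤ) ^ j - 1)) U with hU'
  have hU'G : ∀ x κ, U' x κ ∈ G := clampCfg_mem hU
  have hUU : ∀ x κ, U x κ ∈ U1 𝔸 := fun x κ => hG.le_U1 (hU x κ)
  have hreg' : pdev U' < 2 * (L : ℝ) ^ 2 * B₃ * ε * (((L : ℝ) ^ k)⁻¹) ^ 2 :=
    (pdev_clampCfg_le hlohi hUU).trans_lt hreg
  have h := loop44_le L hL hG k U' hU'G hpos hα3 hα2 hreg' hj y x μ hsmall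
  have hagree : AgreeOn lo hi (avgIter L U' j) (avgIter L U j) :=
    agreeOn_avgIter_of_agreeOn_fine L hL1 j (clampCfg_agree U)
  rw [← B27_congr hagree y x μ hy hx hxe]
  exact h

/-- **The factor of (44), regularity PLAQUETTE BY PLAQUETTE on the fine box** (strictness of the supremum by finiteness,
`B8Ineq132.pdevOn_lt_of_forall`): as `loop44_le_local`, assuming `|U_k(∂p) − 1| < 2L²B₃εη²` for every unit plaquette `p =
(z; κ, κ′)` with `z` and `z + e_κ + e_κ′` in the fine box. [cite: Balaban1985UV3, (44) p.267] -/
theorem loop44_le_local_of_forall (L : ℕ) (hL : 2 ≤ L) {G : Subgroup 𝔸ˣ} (hG : AvgClosed d L G) (k : ℕ)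
    (U : Site d → Fin d → 𝔸ˣ) (hU : ∀ x κ, U x κ ∈ G) {B₃ ε : ℝ} (hpos : 0 < (L : ℝ) ^ 2 * B₃ * ε)
    (hα3 : C0 d * (2 * (L : ℝ) ^ 2 * B₃ * ε) ≤ 1 / 3) (hα2 : 2 * (2 * (L : ℝ) ^ 2 * B₃ * ε) ≤ c2' d L)
    {j : ℕ} (hj : j ≤ k) {lo hi : Site d} (y x : Site d) (μ : Fin d) (hy : InBox lo hi y) (hx : InBox lo hi x)
    (hxe : InBox lo hi (x + e μ))
    (hreg : ∀ (z : Site d) (κ κ' : Fin d), InBox (loK L j lo) (fun i => (L : ℤ) ^ j * hi i + ((L : ℤ) ^ j - 1)) z →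
      InBox (loK L j lo) (fun i => (L : ℤ) ^ j * hi i + ((L : ℤ) ^ j - 1)) (z + e κ + e κ') →
        ‖((hol U z (plaqWord κ κ') : 𝔸ˣ) : 𝔸) - 1‖ < 2 * (L : ℝ) ^ 2 * B₃ * ε * (((L : ℝ) ^ k)⁻¹) ^ 2)
    (hsmall : (l1 (x - y) : ℝ) * (4 * (L : ℝ) ^ 2 * B₃ * ε * ((L : ℝ) ^ j * ((L : ℝ) ^ k)⁻¹) ^ 2) ≤ 1 / 2) :
    ‖B27 (avgIter L U j) y x μ‖
      ≤ (l1 (x - y) : ℝ) * (8 * (L : ℝ) ^ 2 * B₃ * ε * ((L : ℝ) ^ j * ((L : ℝ) ^ k)⁻¹) ^ 2) := by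
  have hLr : (2 : ℝ) ≤ L := by exact_mod_cast hL
  have hL0 : (0 : ℝ) < L := by linarith
  have hδ : 0 < 2 * (L : ℝ) ^ 2 * B₃ * ε * (((L : ℝ) ^ k)⁻¹) ^ 2 := by
    have h := mul_pos hpos (pow_pos (inv_pos.mpr (pow_pos hL0 k)) 2)
    linarith
  exact loop44_le_local L hL hG k U hU hpos hα3 hα2 hj y x μ hy hx hxe (pdevOn_lt_of_forall hδ hreg) hsmall

end Loop

/-! ## §3 `G = U(N) ⊂ M_N(ℂ)`, operator norm -/

section Matrices

open scoped Matrix.Norms.L2Operator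

/-- **The factor of (44) with the printed locality, for `G = U(N)`, `N ≥ 1`, operator norm (19) of [4]**
(`loop44_le_local_of_forall` in the paper's setting). [cite: Balaban1985UV3, (44) p.267] -/
theorem loop44_le_local_unitaryGroup (N : ℕ) [NeZero N] (L : ℕ) (hL : 2 ≤ L) (k : ℕ)
    (U : Site d → Fin d → (Matrix (Fin N) (Fin N) ℂ)ˣ)
    (hU : ∀ x κ, U x κ ∈ unitaryUnits (Matrix (Fin N) (Fin N) ℂ)) {B₃ ε : ℝ}
    (hpos : 0 < (L : ℝ) ^ 2 * B₃ * ε) (hα3 : C0 d * (2 * (L : ℝ) ^ 2 * B₃ * ε) ≤ 1 / 3)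
    (hα2 : 2 * (2 * (L : ℝ) ^ 2 * B₃ * ε) ≤ c2' d L) {j : ℕ} (hj : j ≤ k) {lo hi : Site d} (y x : Site d)
    (μ : Fin d) (hy : InBox lo hi y) (hx : InBox lo hi x) (hxe : InBox lo hi (x + e μ))
    (hreg : ∀ (z : Site d) (κ κ' : Fin d), InBox (loK L j lo) (fun i => (L : ℤ) ^ j * hi i + ((L : ℤ) ^ j - 1)) z →
      InBox (loK L j lo) (fun i => (L : ℤ) ^ j * hi i + ((L : ℤ) ^ j - 1)) (z + e κ + e κ') →
        ‖((hol U z (plaqWord κ κ') : (Matrix (Fin N) (Fin N) ℂ)ˣ) : Matrix (Fin N) (Fin N) ℂ) - 1‖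
          < 2 * (L : ℝ) ^ 2 * B₃ * ε * (((L : ℝ) ^ k)⁻¹) ^ 2)
    (hsmall : (l1 (x - y) : ℝ) * (4 * (L : ℝ) ^ 2 * B₃ * ε * ((L : ℝ) ^ j * ((L : ℝ) ^ k)⁻¹) ^ 2) ≤ 1 / 2) :
    ‖B27 (avgIter L U j) y x μ‖
      ≤ (l1 (x - y) : ℝ) * (8 * (L : ℝ) ^ 2 * B₃ * ε * ((L : ℝ) ^ j * ((L : ℝ) ^ k)⁻¹) ^ 2) := by
  letI : CStarAlgebra (Matrix (Fin N) (Fin N) ℂ) := {}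
  exact loop44_le_local_of_forall L hL (avgClosed_unitaryUnits d L) k U hU hpos hα3 hα2 hj y x μ hy hx hxe hreg hsmall

end Matrices

end Literature.MathematicalPhysics.QuantumFieldTheory.Balaban1983to89.B10Eq44LoopLocal

end
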